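import Summits.ResolutionOfSingularities.ResolutionOfSingularities.Theorems.FrobeniusLadderFInjectiveMacaulayficationMonomialCoverRecord
import Mathlib.LinearAlgebra.Matrix.NonsingularInverse
import HarnessLib

/-!
# The 3-chart fan of the blowing up of 𝔸⁴ along a COORDINATE LINE `V(u_J)`, `J ⊂ {0,1,2,3}`, `|J| = 3` — fan-side binders of
# `CICertificates.ciCertificates` for the LEVEL-2 step of the E7 two-level instances (T₁₁/3: charts 64 with `J = {0,2,3}` and 66 with `J = {0,1,2}`)
# (crux `FInjectiveMacaulayfication` stmt-ResolutionOfSingularities-15315, chain w45a; E7 wiring v2 / LEVEL-2 BINDER SHAPE, STATUS 2026-08-27T13:01:47Z (iii))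

[OURS · L1 W4.5a · res-L1-w45a-lead-1 gen 5] Support file (`--supports stmt-ResolutionOfSingularities-15315 --as helper`); NOT a statement of
any manuscript; AI-written, weaker than expert review.

Blowing up `𝔸⁴ = Spec k[u₀,u₁,u₂,u₃]` (or any `V(g) ⊂ 𝔸⁴`) along the line `u_j = 0 (j ∈ J)` is the blow-up of the monomial ideal
`I_A`, `A = {e_j, 2e_j, e_j + e_l : j ∈ J}` (`l` the free index; the SAME ideal as `(u_j : j ∈ J)`, padded so that the chart-edge
condition `hgen` of (C1)/`ciCertificates` is satisfiable), with three charts `c ↔ j_c ∈ J`: `u_i ↦ u_i u_{j_c}` (`i ∈ J ∖ {j_c}`), the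
other variables fixed; vertex `m c = e_{j_c}`, edges `a c i = e_i` (`i ∈ J ∖ {j_c}`), `a c j_c = 2 e_{j_c}`, `a c l = e_{j_c} + e_l`.
Two literal tables (`Fan023`: `J = {0,2,3}`, `l = 1`; `Fan012`: `J = {0,1,2}`, `l = 3`), every numeric fact by `decide`, delivered in
the binder shapes of `CICertificates.ciCertificates` (`hprim hcov hV haA hgen hge`, and `hunit` for exceptional multiplicities
`d c 0 = μ_c • e_{j_c}`), exactly as res-L1-w45a-stub-3's `T11Char7FanData` does for the 87-chart level-1 fan. Definitions = tables only.
[folklore; toric bookkeeping]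
-/

-- single-problem summit: the doubled namespace component is forced
set_option linter.dupNamespace false

namespace Summit.ResolutionOfSingularities.ResolutionOfSingularities.Theorems.FInjectiveMacaulayfication.LineBlowupFan4

open MvPolynomial

/-! ## §1 `J = {0,2,3}` (free index 1) — chart 64 of T₁₁/3 -/
namespace Fan023

/-- The centre's coordinate set. -/
def J : Finset (Fin 4) := {0, 2, 3}

/-- Chart `c` inverts `u_{jc c}`. -/
def jc : Fin 3 → Fin 4 := ![0, 2, 3]

/-- Records `(a, c, r)` with `a = m c + r` (one per element of `A`). [table] -/
def RL : List ((Fin 4 → ℕ) × Fin 3 × (Fin 4 → ℕ)) :=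
  [(![1,0,0,0], 0, ![0,0,0,0]), (![0,0,1,0], 1, ![0,0,0,0]), (![0,0,0,1], 2, ![0,0,0,0]),
   (![2,0,0,0], 0, ![1,0,0,0]), (![0,0,2,0], 1, ![0,0,1,0]), (![0,0,0,2], 2, ![0,0,0,1]),
   (![1,1,0,0], 0, ![0,1,0,0]), (![0,1,1,0], 1, ![0,1,0,0]), (![0,1,0,1], 2, ![0,1,0,0])]

/-- The exponent set `A` of the centre. [table] -/
noncomputable def A : Finset (Fin 4 →₀ ℕ) := (RL.map fun ρ => Finsupp.equivFunOnFinite.symm ρ.1).toFinset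

/-- Vertices (raw). [table] -/
def mF : Fin 3 → (Fin 4 → ℕ) := ![![1,0,0,0], ![0,0,1,0], ![0,0,0,1]]

/-- Edges (raw). [table] -/
def aF : Fin 3 → Fin 4 → (Fin 4 → ℕ) :=
  ![![![2,0,0,0], ![1,1,0,0], ![0,0,1,0], ![0,0,0,1]],
    ![![1,0,0,0], ![0,1,1,0], ![0,0,2,0], ![0,0,0,1]],
    ![![1,0,0,0], ![0,1,0,1], ![0,0,1,0], ![0,0,0,2]]]

/-- Vertices. -/
noncomputable def m : Fin 3 → (Fin 4 →₀ ℕ) := fun c => Finsupp.equivFunOnFinite.symm (mF c)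

/-- Edges. -/
noncomputable def a : Fin 3 → Fin 4 → (Fin 4 →₀ ℕ) := fun c i => Finsupp.equivFunOnFinite.symm (aF c i)

/-- Chart matrices (`θ_c (u_j) = ∏ i, u_i ^ V c i j`). [table] -/
def V : Fin 3 → Matrix (Fin 4) (Fin 4) ℕ :=
  ![!![1,0,1,1; 0,1,0,0; 0,0,1,0; 0,0,0,1],
    !![1,0,0,0; 0,1,0,0; 1,0,1,1; 0,0,0,1],
    !![1,0,0,0; 0,1,0,0; 0,0,1,0; 1,0,1,1]]

/-- Their inverses over `ℤ`. [table] -/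
def U : Fin 3 → Matrix (Fin 4) (Fin 4) ℤ :=
  ![!![1,0,-1,-1; 0,1,0,0; 0,0,1,0; 0,0,0,1],
    !![1,0,0,0; 0,1,0,0; -1,0,1,-1; 0,0,0,1],
    !![1,0,0,0; 0,1,0,0; 0,0,1,0; -1,0,-1,1]]

/-- `V c * U c = 1` over `ℤ`. [table check] -/
theorem V_mul_U : ∀ c : Fin 3, ((V c).map (Nat.cast : ℕ → ℤ)) * U c = 1 := by decide +kernel

/-- The edge relation `V·(a c i) = V·(m c) + e_i`, on tables. [table check] -/
theorem gen_table : ∀ (c : Fin 3) (i j : Fin 4),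
    (V c).mulVec (aF c i) j = (V c).mulVec (mF c) j + (if i = j then 1 else 0) := by decide +kernel

/-- The vertex minimises every `V c`-weight over `A`, on tables. [table check] -/
theorem ge_table : ∀ (c : Fin 3), ∀ ρ ∈ RL, ∀ j : Fin 4, (V c).mulVec (mF c) j ≤ (V c).mulVec ρ.1 j := by decide +kernel

/-- The cover records `a = m c + r`, on tables. [table check] -/
theorem rec_table : ∀ ρ ∈ RL, ∀ j : Fin 4, ρ.1 j = mF ρ.2.1 j + ρ.2.2 j := by decide +kernel

/-- Vertices and edges are elements of `A`, on tables. [table check] -/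
theorem mem_table : ∀ c : Fin 3, (∃ ρ ∈ RL, ρ.1 = mF c) ∧ ∀ i : Fin 4, ∃ ρ ∈ RL, ρ.1 = aF c i := by decide +kernel

/-- The centre variables `u_j`, `j ∈ J`, have their first powers in `A`, on tables. [table check] -/
theorem prim_table : ∀ j ∈ J, ∃ ρ ∈ RL, ρ.1 = fun i => if j = i then 1 else 0 := by decide +kernel

/-- Every exponent of `A` involves a centre variable, on tables. [table check] -/
theorem pos_table : ∀ ρ ∈ RL, ∃ j ∈ J, 0 < ρ.1 j := by decide +kernel

/-- The inverted variable's edge is twice the vertex, on tables. [table check] -/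
theorem two_table : ∀ (c : Fin 3) (j : Fin 4), aF c (jc c) j = 2 * mF c j := by decide +kernel

/-- Membership in `A` from membership in the record list. [folklore] -/
theorem mem_A_of_mem {x : Fin 4 → ℕ} (h : ∃ ρ ∈ RL, ρ.1 = x) : (Finsupp.equivFunOnFinite.symm x : Fin 4 →₀ ℕ) ∈ A := by
  obtain ⟨ρ, hρ, rfl⟩ := h
  exact List.mem_toFinset.mpr (List.mem_map.mpr ⟨ρ, hρ, rfl⟩)

/-- Elements of `A` come from the record list. [folklore] -/
theorem exists_of_mem_A {x : Fin 4 →₀ ℕ} (h : x ∈ A) : ∃ ρ ∈ RL, Finsupp.equivFunOnFinite.symm ρ.1 = x := by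
  obtain ⟨ρ, hρ, h⟩ := List.mem_map.mp (List.mem_toFinset.mp h)
  exact ⟨ρ, hρ, h⟩

/-- `0 < t`. -/
theorem ht : 0 < 3 := by decide

/-- **`hprim`** (pure powers of the centre variables). -/
theorem hprim : ∀ j ∈ J, ∃ N : ℕ, Finsupp.single j N ∈ A := by
  intro j hj
  refine ⟨1, ?_⟩
  have h := mem_A_of_mem (prim_table j hj)
  convert h using 1
  ext i
  simp [Finsupp.single_apply]

/-- **`hAJ`** (every exponent involves a centre variable). -/
theorem hAJ : ∀ x ∈ A, ∃ j ∈ J, 0 < x j := by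
  intro x hx
  obtain ⟨ρ, hρ, rfl⟩ := exists_of_mem_A hx
  obtain ⟨j, hj, h⟩ := pos_table ρ hρ
  exact ⟨j, hj, by simpa using h⟩

/-- **`hcov`** (`K = 1` records). -/
theorem hcov (k : Type) [Field k] : ∀ x ∈ A, ∃ (c : Fin 3) (K : ℕ), 1 ≤ K ∧
    ∃ y ∈ (Ideal.span ((fun b : Fin 4 →₀ ℕ => (MvPolynomial.monomial b (1 : k) : MvPolynomial (Fin 4) k)) ''
        (A : Set (Fin 4 →₀ ℕ)))) ^ (K - 1),
      (MvPolynomial.monomial x (1 : k) : MvPolynomial (Fin 4) k) ^ K = MvPolynomial.monomial (m c) 1 * y := by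
  intro x hx
  obtain ⟨ρ, hρ, rfl⟩ := exists_of_mem_A hx
  refine MonomialCoverRecord.hcov_of_record_one k A m _ ρ.2.1 (Finsupp.equivFunOnFinite.symm ρ.2.2) ?_
  ext j
  simpa [m] using rec_table ρ hρ j

/-- **`hV`**. -/
theorem hV : ∀ c : Fin 3, IsUnit ((V c).map (Nat.cast : ℕ → ℤ)).det :=
  fun c => Matrix.isUnit_det_of_right_inverse (V_mul_U c)

/-- **`haA`**. -/
theorem haA : ∀ (c : Fin 3) (i : Fin 4), a c i ∈ A := fun c i => mem_A_of_mem ((mem_table c).2 i)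

/-- `m c ∈ A`. -/
theorem hmA : ∀ c : Fin 3, m c ∈ A := fun c => mem_A_of_mem (mem_table c).1

/-- **`hgen`**. -/
theorem hgen : ∀ (c : Fin 3) (i : Fin 4),
    (Finsupp.equivFunOnFinite.symm ((V c).mulVec ⇑(a c i)) : Fin 4 →₀ ℕ) =
      Finsupp.equivFunOnFinite.symm ((V c).mulVec ⇑(m c)) + Finsupp.single i 1 := by
  intro c i
  ext j
  simpa [a, m, Finsupp.single_apply] using gen_table c i j

/-- **`hge`**. -/
theorem hge : ∀ (c : Fin 3), ∀ e ∈ A,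
    (Finsupp.equivFunOnFinite.symm ((V c).mulVec ⇑(m c)) : Fin 4 →₀ ℕ) ≤
      Finsupp.equivFunOnFinite.symm ((V c).mulVec ⇑e) := by
  intro c e he
  obtain ⟨ρ, hρ, rfl⟩ := exists_of_mem_A he
  exact Finsupp.le_def.mpr fun j => by simpa [m] using ge_table c ρ hρ j

/-- **`hunit`** for exceptional multiplicities `d c 0 = μ c • e_{jc c}`: `(2 μ c) • m c = ∑ j, d c 0 j • a c j + 0`. -/
theorem hunit (μ : Fin 3 → ℕ) (d : Fin 3 → Fin 1 → (Fin 4 →₀ ℕ)) (hd : ∀ c, d c 0 = Finsupp.single (jc c) (μ c)) :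
    ∀ (c : Fin 3) (l : Fin 1), ∃ (N : ℕ) (r' : Fin 4 →₀ ℕ), N • m c = ∑ j : Fin 4, d c l j • a c j + r' := by
  intro c l
  rw [Fin.fin_one_eq_zero l]
  refine ⟨2 * μ c, 0, ?_⟩
  rw [add_zero, hd c]
  rw [Finset.sum_eq_single (jc c) (fun j _ hj => by rw [Finsupp.single_eq_of_ne hj, zero_smul])
    (fun h => absurd (Finset.mem_univ _) h), Finsupp.single_eq_same]
  ext j
  simp only [m, a, Finsupp.smul_apply, Finsupp.coe_equivFunOnFinite_symm, smul_eq_mul, two_table c j]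
  ring

/-- **`hzero`**: the vertices lie in the image of the centre in any quotient. -/
theorem hzero (k : Type) [Field k] (F : Ideal (MvPolynomial (Fin 4) k)) : ∀ c : Fin 3,
    Ideal.Quotient.mk F (monomial (m c) (1 : k)) ∈
      (Ideal.span ((fun e : Fin 4 →₀ ℕ => Ideal.Quotient.mk F (monomial e (1 : k))) '' (A : Set (Fin 4 →₀ ℕ)))) :=
  fun c => Ideal.subset_span ⟨m c, hmA c, rfl⟩

end Fan023

/-! ## §2 `J = {0,1,2}` (free index 3) — chart 66 of T₁₁/3 -/
namespace Fan012

/-- The centre's coordinate set. -/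
def J : Finset (Fin 4) := {0, 1, 2}

/-- Chart `c` inverts `u_{jc c}`. -/
def jc : Fin 3 → Fin 4 := ![0, 1, 2]

/-- Records `(a, c, r)` with `a = m c + r` (one per element of `A`). [table] -/
def RL : List ((Fin 4 → ℕ) × Fin 3 × (Fin 4 → ℕ)) :=
  [(![1,0,0,0], 0, ![0,0,0,0]), (![0,1,0,0], 1, ![0,0,0,0]), (![0,0,1,0], 2, ![0,0,0,0]),
   (![2,0,0,0], 0, ![1,0,0,0]), (![0,2,0,0], 1, ![0,1,0,0]), (![0,0,2,0], 2, ![0,0,1,0]),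
   (![1,0,0,1], 0, ![0,0,0,1]), (![0,1,0,1], 1, ![0,0,0,1]), (![0,0,1,1], 2, ![0,0,0,1])]

/-- The exponent set `A` of the centre. [table] -/
noncomputable def A : Finset (Fin 4 →₀ ℕ) := (RL.map fun ρ => Finsupp.equivFunOnFinite.symm ρ.1).toFinset

/-- Vertices (raw). [table] -/
def mF : Fin 3 → (Fin 4 → ℕ) := ![![1,0,0,0], ![0,1,0,0], ![0,0,1,0]]

/-- Edges (raw). [table] -/
def aF : Fin 3 → Fin 4 → (Fin 4 → ℕ) :=
  ![![![2,0,0,0], ![0,1,0,0], ![0,0,1,0], ![1,0,0,1]],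
    ![![1,0,0,0], ![0,2,0,0], ![0,0,1,0], ![0,1,0,1]],
    ![![1,0,0,0], ![0,1,0,0], ![0,0,2,0], ![0,0,1,1]]]

/-- Vertices. -/
noncomputable def m : Fin 3 → (Fin 4 →₀ ℕ) := fun c => Finsupp.equivFunOnFinite.symm (mF c)

/-- Edges. -/
noncomputable def a : Fin 3 → Fin 4 → (Fin 4 →₀ ℕ) := fun c i => Finsupp.equivFunOnFinite.symm (aF c i)

/-- Chart matrices (`θ_c (u_j) = ∏ i, u_i ^ V c i j`). [table] -/
def V : Fin 3 → Matrix (Fin 4) (Fin 4) ℕ :=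
  ![!![1,1,1,0; 0,1,0,0; 0,0,1,0; 0,0,0,1],
    !![1,0,0,0; 1,1,1,0; 0,0,1,0; 0,0,0,1],
    !![1,0,0,0; 0,1,0,0; 1,1,1,0; 0,0,0,1]]

/-- Their inverses over `ℤ`. [table] -/
def U : Fin 3 → Matrix (Fin 4) (Fin 4) ℤ :=
  ![!![1,-1,-1,0; 0,1,0,0; 0,0,1,0; 0,0,0,1],
    !![1,0,0,0; -1,1,-1,0; 0,0,1,0; 0,0,0,1],
    !![1,0,0,0; 0,1,0,0; -1,-1,1,0; 0,0,0,1]]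

/-- `V c * U c = 1` over `ℤ`. [table check] -/
theorem V_mul_U : ∀ c : Fin 3, ((V c).map (Nat.cast : ℕ → ℤ)) * U c = 1 := by decide +kernel

/-- The edge relation `V·(a c i) = V·(m c) + e_i`, on tables. [table check] -/
theorem gen_table : ∀ (c : Fin 3) (i j : Fin 4),
    (V c).mulVec (aF c i) j = (V c).mulVec (mF c) j + (if i = j then 1 else 0) := by decide +kernel

/-- The vertex minimises every `V c`-weight over `A`, on tables. [table check] -/
theorem ge_table : ∀ (c : Fin 3), ∀ ρ ∈ RL, ∀ j : Fin 4, (V c).mulVec (mF c) j ≤ (V c).mulVec ρ.1 j := by decide +kernel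

/-- The cover records `a = m c + r`, on tables. [table check] -/
theorem rec_table : ∀ ρ ∈ RL, ∀ j : Fin 4, ρ.1 j = mF ρ.2.1 j + ρ.2.2 j := by decide +kernel

/-- Vertices and edges are elements of `A`, on tables. [table check] -/
theorem mem_table : ∀ c : Fin 3, (∃ ρ ∈ RL, ρ.1 = mF c) ∧ ∀ i : Fin 4, ∃ ρ ∈ RL, ρ.1 = aF c i := by decide +kernel

/-- The centre variables `u_j`, `j ∈ J`, have their first powers in `A`, on tables. [table check] -/
theorem prim_table : ∀ j ∈ J, ∃ ρ ∈ RL, ρ.1 = fun i => if j = i then 1 else 0 := by decide +kernel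

/-- Every exponent of `A` involves a centre variable, on tables. [table check] -/
theorem pos_table : ∀ ρ ∈ RL, ∃ j ∈ J, 0 < ρ.1 j := by decide +kernel

/-- The inverted variable's edge is twice the vertex, on tables. [table check] -/
theorem two_table : ∀ (c : Fin 3) (j : Fin 4), aF c (jc c) j = 2 * mF c j := by decide +kernel

/-- Membership in `A` from membership in the record list. [folklore] -/
theorem mem_A_of_mem {x : Fin 4 → ℕ} (h : ∃ ρ ∈ RL, ρ.1 = x) : (Finsupp.equivFunOnFinite.symm x : Fin 4 →₀ ℕ) ∈ A := by
  obtain ⟨ρ, hρ, rfl⟩ := h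
  exact List.mem_toFinset.mpr (List.mem_map.mpr ⟨ρ, hρ, rfl⟩)

/-- Elements of `A` come from the record list. [folklore] -/
theorem exists_of_mem_A {x : Fin 4 →₀ ℕ} (h : x ∈ A) : ∃ ρ ∈ RL, Finsupp.equivFunOnFinite.symm ρ.1 = x := by
  obtain ⟨ρ, hρ, h⟩ := List.mem_map.mp (List.mem_toFinset.mp h)
  exact ⟨ρ, hρ, h⟩

/-- `0 < t`. -/
theorem ht : 0 < 3 := by decide

/-- **`hprim`** (pure powers of the centre variables). -/
theorem hprim : ∀ j ∈ J, ∃ N : ℕ, Finsupp.single j N ∈ A := by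
  intro j hj
  refine ⟨1, ?_⟩
  have h := mem_A_of_mem (prim_table j hj)
  convert h using 1
  ext i
  simp [Finsupp.single_apply]

/-- **`hAJ`** (every exponent involves a centre variable). -/
theorem hAJ : ∀ x ∈ A, ∃ j ∈ J, 0 < x j := by
  intro x hx
  obtain ⟨ρ, hρ, rfl⟩ := exists_of_mem_A hx
  obtain ⟨j, hj, h⟩ := pos_table ρ hρ
  exact ⟨j, hj, by simpa using h⟩

/-- **`hcov`** (`K = 1` records). -/
theorem hcov (k : Type) [Field k] : ∀ x ∈ A, ∃ (c : Fin 3) (K : ℕ), 1 ≤ K ∧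
    ∃ y ∈ (Ideal.span ((fun b : Fin 4 →₀ ℕ => (MvPolynomial.monomial b (1 : k) : MvPolynomial (Fin 4) k)) ''
        (A : Set (Fin 4 →₀ ℕ)))) ^ (K - 1),
      (MvPolynomial.monomial x (1 : k) : MvPolynomial (Fin 4) k) ^ K = MvPolynomial.monomial (m c) 1 * y := by
  intro x hx
  obtain ⟨ρ, hρ, rfl⟩ := exists_of_mem_A hx
  refine MonomialCoverRecord.hcov_of_record_one k A m _ ρ.2.1 (Finsupp.equivFunOnFinite.symm ρ.2.2) ?_
  ext j
  simpa [m] using rec_table ρ hρ j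

/-- **`hV`**. -/
theorem hV : ∀ c : Fin 3, IsUnit ((V c).map (Nat.cast : ℕ → ℤ)).det :=
  fun c => Matrix.isUnit_det_of_right_inverse (V_mul_U c)

/-- **`haA`**. -/
theorem haA : ∀ (c : Fin 3) (i : Fin 4), a c i ∈ A := fun c i => mem_A_of_mem ((mem_table c).2 i)

/-- `m c ∈ A`. -/
theorem hmA : ∀ c : Fin 3, m c ∈ A := fun c => mem_A_of_mem (mem_table c).1

/-- **`hgen`**. -/
theorem hgen : ∀ (c : Fin 3) (i : Fin 4),
    (Finsupp.equivFunOnFinite.symm ((V c).mulVec ⇑(a c i)) : Fin 4 →₀ ℕ) =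
      Finsupp.equivFunOnFinite.symm ((V c).mulVec ⇑(m c)) + Finsupp.single i 1 := by
  intro c i
  ext j
  simpa [a, m, Finsupp.single_apply] using gen_table c i j

/-- **`hge`**. -/
theorem hge : ∀ (c : Fin 3), ∀ e ∈ A,
    (Finsupp.equivFunOnFinite.symm ((V c).mulVec ⇑(m c)) : Fin 4 →₀ ℕ) ≤
      Finsupp.equivFunOnFinite.symm ((V c).mulVec ⇑e) := by
  intro c e he
  obtain ⟨ρ, hρ, rfl⟩ := exists_of_mem_A he
  exact Finsupp.le_def.mpr fun j => by simpa [m] using ge_table c ρ hρ j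

/-- **`hunit`** for exceptional multiplicities `d c 0 = μ c • e_{jc c}`: `(2 μ c) • m c = ∑ j, d c 0 j • a c j + 0`. -/
theorem hunit (μ : Fin 3 → ℕ) (d : Fin 3 → Fin 1 → (Fin 4 →₀ ℕ)) (hd : ∀ c, d c 0 = Finsupp.single (jc c) (μ c)) :
    ∀ (c : Fin 3) (l : Fin 1), ∃ (N : ℕ) (r' : Fin 4 →₀ ℕ), N • m c = ∑ j : Fin 4, d c l j • a c j + r' := by
  intro c l
  rw [Fin.fin_one_eq_zero l]
  refine ⟨2 * μ c, 0, ?_⟩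
  rw [add_zero, hd c]
  rw [Finset.sum_eq_single (jc c) (fun j _ hj => by rw [Finsupp.single_eq_of_ne hj, zero_smul])
    (fun h => absurd (Finset.mem_univ _) h), Finsupp.single_eq_same]
  ext j
  simp only [m, a, Finsupp.smul_apply, Finsupp.coe_equivFunOnFinite_symm, smul_eq_mul, two_table c j]
  ring

/-- **`hzero`**: the vertices lie in the image of the centre in any quotient. -/
theorem hzero (k : Type) [Field k] (F : Ideal (MvPolynomial (Fin 4) k)) : ∀ c : Fin 3,
    Ideal.Quotient.mk F (monomial (m c) (1 : k)) ∈
      (Ideal.span ((fun e : Fin 4 →₀ ℕ => Ideal.Quotient.mk F (monomial e (1 : k))) '' (A : Set (Fin 4 →₀ ℕ)))) :=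
  fun c => Ideal.subset_span ⟨m c, hmA c, rfl⟩

end Fan012

end Summit.ResolutionOfSingularities.ResolutionOfSingularities.Theorems.FInjectiveMacaulayfication.LineBlowupFan4
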